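import Summits.QuantumFields.YangMills.Theorems.BalabanUVNodesN06Eq3132Ineq2142KnitQ
import Literature.MathematicalPhysics.QuantumFieldTheory.Balaban1983to89.B9Eq3132DecayFromMajorantR

/-!
# BalabanUVNodes ∕ N06 ([B9], `Dag.B9_main`) — ROW 26 AT THE KNIT PAIR, PIECE 2: THE `DecayUnder` INPUT OF THE ROW-26 COMBES–THOMAS FACE FOR THE Λ-NORMALISED
# `Q(U) T(U) Q⋆(U)` AT PRINT's KNIT AVERAGING, FROM A FAMILY OF BLOCK MAJORANTS OF `T(U)`, OVER THE CLASS-PARAMETRIC CARRIER `bg9YR … G R₁ R₂`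

Track A of `YM-PLAN.md` (cell `pub-ymgap`, HUMAN RULING D-0062), node **N06** = [Balaban1985BackgroundPropagators]; the knit certificate «KA» (✓p779333) displays ROW 26 as
`s3132K`.  THIS FILE is piece 2 of the knit road «P-Q26-knit» (seat `pub-ymgap-dag-n06-l` g37, 2026-08-30): dag-n06-i's `B9Eq3132DecayFromMajorantR.decayUnder_QGQOfY_of_majorants_R`
re-pressed for def-Y's `QGQOfQY x.toKIdx (𝔮 x) (𝔮⋆ x) (T x) U` at ANY letter families pinned to the knit pair (`𝔮 x U = QknitY x.toKIdx U`, `𝔮⋆ x U = adjTrY (QknitY x.toKIdx U)` —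
def-Y's `qKnitOfRecord ∕ qsKnitOfRecord` by `rfl`), the straight pair's contractive taxi transports replaced by the knit row∕column kernel bounds of piece 1
(`norm_QGQOfQY_deltaY_le_knit`), read on the member's local class `(bg9KP …).Reg335 c₀` through the displayed regime bridge `hRP` and the x-free knit numerics
(`0 < α₀′ ≤ α_Q`, `hKpl : 0 ≤ a ≤ aK ⇒ K_pl(a)·L⁴ < α₀′`) — the shapes of ✓p780031 `hqK_knit_of_laws`.

HONEST FRAMING.  Bookkeeping over landed objects; the block majorants of `T(U)` are a HYPOTHESIS (row 20's state supplies them downstream, letter-generically: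
`B9Eq3132FromStateR.majorants4_of_stepS_R`); nothing of [B9] ∕ [4] asserted; COUNT-NEUTRAL; N06 NOT discharged; K1⁹ NOT closed; nothing continuum ∕ OS ∕ mass gap ∕ Clay.
0 `def`, 0 `sorry`.  [cite: Balaban1985BackgroundPropagators, (3.132) p.422, Thm 3.12 p.423 (prefix), (3.115) p.418, (3.35)–(3.36) p.396; Balaban1984PropagatorsII, (2.142) p.248,
(2.149) p.249, Lemma 2.1 (2.60) p.234; Balaban1985Averaging, (139)–(147) pp.39–40]
-/

noncomputable section

namespace Summit.QuantumFields.YangMills.BalabanUVNodes.N06Eq3132DecayFromMajorantKnitQ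

open scoped Matrix.Norms.L2Operator
open Literature.MathematicalPhysics.QuantumFieldTheory.Balaban1983to89
open Literature.MathematicalPhysics.QuantumFieldTheory.Balaban1983to89.Node00
open Literature.MathematicalPhysics.QuantumFieldTheory.Balaban1983to89.B6RandomWalk (HasMajorant)
open Literature.MathematicalPhysics.QuantumFieldTheory.Balaban1983to89.B9CoReadingCoords (XBK blkBK GcoK)
open Literature.MathematicalPhysics.QuantumFieldTheory.Balaban1983to89.B9Thm39ReadingCoords (basisBound39)
open Literature.MathematicalPhysics.QuantumFieldTheory.Balaban1983to89.B6Ineq2142KLevelV1 (lvl β)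
open Literature.MathematicalPhysics.QuantumFieldTheory.Balaban1983to89.B9Eq3132Ineq2142Covariant (abs_normMatY_le levelFactor_le)
open Literature.MathematicalPhysics.QuantumFieldTheory.Balaban1983to89.B9Eq3132DecayFromMajorant (norm_basis_le)
open Literature.MathematicalPhysics.QuantumFieldTheory.Balaban1983to89.B6KLevelCensusIndexV1 (KIdx kGeo)
open Literature.MathematicalPhysics.QuantumFieldTheory.Balaban1983to89.B6GlobalChartV1 (blkV1)
open Literature.MathematicalPhysics.QuantumFieldTheory.Balaban1983to89.B9Thm34Ext (toB6)
open Literature.MathematicalPhysics.QuantumFieldTheory.Balaban1983to89.B9PinMembersKLevelV1 (MemberY geo9Y bg9Y)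
open Literature.MathematicalPhysics.QuantumFieldTheory.Balaban1983to89.B9BackgroundsKLevelV1R (RegFamY bg9YR)
open Literature.MathematicalPhysics.QuantumFieldTheory.Balaban1983to89.B9GeoLemma21KLevelV1 (geo9K_len_pos)
open Literature.MathematicalPhysics.QuantumFieldTheory.Balaban1983to89.B9GeoNormsKLevelV1 (geo9K)
open Literature.MathematicalPhysics.QuantumFieldTheory.Balaban1983to89.B9RWSumsReadsNbr (nbr)
open Literature.MathematicalPhysics.QuantumFieldTheory.Balaban1983to89.B9Eq3132RingInverseReading (normMatY dimConstY' dimConstY'_pos)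
open Literature.MathematicalPhysics.QuantumFieldTheory.Balaban1983to89.B9Eq3132NuReading (lamInvY lamInvY_pos)
open Literature.MathematicalPhysics.QuantumFieldTheory.Balaban1983to89.B9Eq3132CTInputs (DecayUnder)
open Literature.MathematicalPhysics.QuantumFieldTheory.Balaban1983to89.B9Eq3132ScalarIndex (geoComap)
open Literature.MathematicalPhysics.QuantumFieldTheory.Balaban1983to89.Node00.OpsYQLetter (QLetterY QsLetterY adjTrY)
open Literature.MathematicalPhysics.QuantumFieldTheory.Balaban1983to89.B9Eq316AveragingTransposeZd (alphaQ)
open Literature.MathematicalPhysics.QuantumFieldTheory.Balaban1983to89.B9Eq3115KnitLetterY (QknitY)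
open Literature.MathematicalPhysics.QuantumFieldTheory.Balaban1983to89.B9Eq3115KnitLetterYOnto (kCol kCol_nonneg)
open Literature.MathematicalPhysics.QuantumFieldTheory.Balaban1983to89.B9C2FormBoxRegimeY (Kpl)
open Literature.MathematicalPhysics.QuantumFieldTheory.Balaban1983to89.B9BackgroundsKLevelV1P (bg9KP)
open Literature.MathematicalPhysics.QuantumFieldTheory.Balaban1983to89.B7Prop2Explicit (unitaryUnits)
open Summit.QuantumFields.YangMills.BalabanUVNodes.N06Eq3132Ineq2142KnitQ (norm_QGQOfQY_deltaY_le_knit)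

variable {N : ℕ} [Nonempty (Fin N)]
variable {κ : Type} [Fintype κ] [DecidableEq κ] {Ff : Type} [Fintype Ff] [DecidableEq Ff]
variable {d ℓ : ℕ} {hd : 1 ≤ d + 1} {hL : Odd (ℓ + 1) ∧ 1 < ℓ + 1} {b₀ b₁ : ℝ} {Mstar : ℕ}
variable {G : Subgroup (Matrix (Fin N) (Fin N) ℂ)ˣ}
variable (R₁ R₂ : RegFamY d ℓ hd hL b₀ b₁ Mstar (Matrix (Fin N) (Fin N) ℂ))

/-- ★★ **`DecayUnder` FOR THE Λ-NORMALISED `Q(U) T(U) Q⋆(U)` AT THE KNIT PAIR FROM A FAMILY OF BLOCK MAJORANTS, OVER `bg9YR … G R₁ R₂`** (the knit twin of dag-n06-i's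
`decayUnder_QGQOfY_of_majorants_R`, same proof text): letter families `𝔮, 𝔮⋆` pinned to `QknitY ∕ adjTrY (QknitY ·)`; `G ≤ U(N)`; the regime bridge
`hRP : (bg9YR … x).Reg335 c35 α₀ U → (bg9KP … G x.toKIdx).Reg335 c₀ α₀ U` (`c₀ ≤ 10`); x-free numerics `0 < α₀′ ≤ α_Q`, `hKpl`; `bI` level-∕1-faithful, count `mN`; the family of [4]-(2.51)
majorants `C(Lʲη)²e^{−δd}` of `GcoK … (T x) U` above `M₂` and below `Mα₀ ≤ a₂`.  THEN the real matrix `diag(Λ⁻¹∕κ′)·reMatY(Q T(U) Q⋆)·diag(Λ⁻¹)` decays like `B·e^{−(δ∕2)d}` above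
`max(M₂, (d+3)log L ∕ (δ(2L²−1)))` and below `min(a₂, aK)`. [cite: Balaban1985BackgroundPropagators, (3.132) p.422, Thm 3.12 p.423, (3.115) p.418, (3.35) p.396; Balaban1984PropagatorsII, (2.142) p.248, (2.149) p.249, (2.60) p.234] -/
theorem decayUnder_QGQOfQY_knit_of_majorants_R (hGU : G ≤ unitaryUnits (Matrix (Fin N) (Fin N) ℂ))
    [∀ x : MemberY d ℓ hd hL b₀ b₁ Mstar, Fintype (geo9Y x).Site]
    [∀ x : MemberY d ℓ hd hL b₀ b₁ Mstar, DecidableEq (geo9Y x).Site] (bK : Module.Basis κ ℝ (Matrix (Fin N) (Fin N) ℂ)) (b : Module.Basis Ff ℝ (Matrix (Fin N) (Fin N) ℂ))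
    {c35 : ℝ} (T : ∀ x : MemberY d ℓ hd hL b₀ b₁ Mstar, BondOpY (Matrix (Fin N) (Fin N) ℂ) x.toKIdx)
    (𝔮 : ∀ x : MemberY d ℓ hd hL b₀ b₁ Mstar, QLetterY (Matrix (Fin N) (Fin N) ℂ) x.toKIdx)
    (𝔮s : ∀ x : MemberY d ℓ hd hL b₀ b₁ Mstar, QsLetterY (Matrix (Fin N) (Fin N) ℂ) x.toKIdx)
    (h𝔮 : ∀ (x : MemberY d ℓ hd hL b₀ b₁ Mstar) (U : CfgY (Matrix (Fin N) (Fin N) ℂ) x.toKIdx), 𝔮 x U = QknitY x.toKIdx U)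
    (h𝔮s : ∀ (x : MemberY d ℓ hd hL b₀ b₁ Mstar) (U : CfgY (Matrix (Fin N) (Fin N) ℂ) x.toKIdx), 𝔮s x U = adjTrY (QknitY x.toKIdx U))
    {c₀ : ℝ} (hc : c₀ ≤ 10)
    (hRP : ∀ (x : MemberY d ℓ hd hL b₀ b₁ Mstar) (α₀ : ℝ) (U : (bg9YR (Matrix (Fin N) (Fin N) ℂ) G R₁ R₂ x).Cfg),
      (bg9YR (Matrix (Fin N) (Fin N) ℂ) G R₁ R₂ x).Reg335 c35 α₀ U → (bg9KP (Matrix (Fin N) (Fin N) ℂ) G x.toKIdx).Reg335 c₀ α₀ U)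
    {α₀' : ℝ} (hα' : 0 < α₀') (hαQ : α₀' ≤ alphaQ (d + 1) (ℓ + 1)) {aK : ℝ} (haK : 0 < aK)
    (hKpl : ∀ (x : MemberY d ℓ hd hL b₀ b₁ Mstar) (a : ℝ), 0 ≤ a → a ≤ aK → Kpl x.toKIdx a * (kGeo x.toKIdx).L ^ 4 < α₀')
    {bI : ∀ x : MemberY d ℓ hd hL b₀ b₁ Mstar, FBondY x.toKIdx → IBondY x.toKIdx}
    (hlev : ∀ (x : MemberY d ℓ hd hL b₀ b₁ Mstar) (f : FBondY x.toKIdx), lvl x.hN x.D x.hk (bI x f) = (blkV1 x.hN x.D f).1.1)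
    (hβ1 : ∀ (x : MemberY d ℓ hd hL b₀ b₁ Mstar) (f : FBondY x.toKIdx), (B6Geom246MultiLevelTorus.geomT x.D).dist (β x.hN x.D x.hk (bI x f)) (blkV1 x.hN x.D f) ≤ 1)
    {mN : ℕ} (hnbr : ∀ (x : MemberY d ℓ hd hL b₀ b₁ Mstar) (y : (geo9Y x).Site), (nbr (geo9Y x) ((ℓ : ℝ) + 4) y).card ≤ mN)
    {R : MemberY d ℓ hd hL b₀ b₁ Mstar → ℝ} {H : MemberY d ℓ hd hL b₀ b₁ Mstar → Prop}
    (h : ∃ M₂ a₂ C δ : ℝ, 0 < M₂ ∧ 0 < a₂ ∧ 0 ≤ C ∧ 0 < δ ∧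
      ∀ x : MemberY d ℓ hd hL b₀ b₁ Mstar, M₂ ≤ (geo9Y x).M → ∀ α₀ : ℝ, 0 < α₀ → (geo9Y x).M * α₀ ≤ a₂ →
        ∀ U : (bg9YR (Matrix (Fin N) (Fin N) ℂ) G R₁ R₂ x).Cfg,
          (bg9YR (Matrix (Fin N) (Fin N) ℂ) G R₁ R₂ x).Reg335 c35 α₀ U → (bg9YR (Matrix (Fin N) (Fin N) ℂ) G R₁ R₂ x).Reg336 c35 α₀ U →
          HasMajorant (g := toB6 (geo9Y x) (R x) (H x)) (blkBK x.toKIdx (bI x)) (GcoK x.toKIdx bK (bg9YR (Matrix (Fin N) (Fin N) ℂ) G R₁ R₂ x) (fun U => U) (T x) U)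
            (fun a a' => C * (geo9Y x).len a ^ 2 * Real.exp (-(δ * (geo9Y x).dist a a')))) :
    DecayUnder c35 (fun x : MemberY d ℓ hd hL b₀ b₁ Mstar => geoComap (geo9Y x) (Prod.fst : (geo9Y x).Site × Ff → (geo9Y x).Site))
      (bg9YR (Matrix (Fin N) (Fin N) ℂ) G R₁ R₂) (fun x U => normMatY b (lamInvY x.toKIdx) (QGQOfQY x.toKIdx (𝔮 x) (𝔮s x) (T x) U)) := by
  obtain ⟨M₂, a₂, C, δ, hM₂, ha₂, hC, hδ, hmaj⟩ := h
  -- the knit constant in front of `C`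
  set CK : ℝ := (1 + kCol (d + 1) (ℓ + 1) * α₀' * (2 * ((d : ℝ) + 1))) * (N : ℝ) ^ 4 * (1 + kCol (d + 1) (ℓ + 1) * α₀') * C with hCK
  have hkc : 0 ≤ kCol (d + 1) (ℓ + 1) * α₀' := mul_nonneg (kCol_nonneg _ _) hα'.le
  have hCK0 : 0 ≤ CK := by rw [hCK]; positivity
  -- the constants: the (2.60) threshold, the prefactor
  set L : ℝ := ((ℓ + 1 : ℕ) : ℝ) with hLdef
  have hL1 : (1 : ℝ) ≤ L := by rw [hLdef]; exact_mod_cast Nat.succ_le_succ (Nat.zero_le ℓ)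
  set MT : ℝ := ((d : ℝ) + 3) * Real.log L / (δ * (2 * ((ℓ : ℝ) + 1) ^ 2 - 1)) with hMT
  have hden : 0 < δ * (2 * ((ℓ : ℝ) + 1) ^ 2 - 1) := mul_pos hδ (by nlinarith [(Nat.cast_nonneg ℓ : (0 : ℝ) ≤ ℓ)])
  set B : ℝ := basisBound39 b * (‖(b.equivFunL : Matrix (Fin N) (Fin N) ℂ →L[ℝ] (Ff → ℝ))‖ / dimConstY' b) * (mN * CK * Real.exp (2 * (δ * ((ℓ : ℝ) + 4)))) *
    L ^ (((d : ℝ) + 3) / 2) with hB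
  have hB0 : 0 ≤ B := by
    rw [hB]
    have : 0 ≤ basisBound39 b := Finset.sum_nonneg fun _ _ => norm_nonneg _
    have := dimConstY'_pos b
    positivity
  refine ⟨max M₂ MT, min a₂ aK, B, δ / 2, lt_of_lt_of_le hM₂ (le_max_left _ _), lt_min ha₂ haK, hB0, half_pos hδ, fun x hM α₀ hα₀ hMa U hU hU' a c => ?_⟩
  have hM2 : M₂ ≤ (geo9Y x).M := (le_max_left _ _).trans hM
  have hMTx : MT ≤ (geo9Y x).M := (le_max_right _ _).trans hM
  have hMa₂ : (geo9Y x).M * α₀ ≤ a₂ := hMa.trans (min_le_left _ _)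
  have hMaK : (geo9Y x).M * α₀ ≤ aK := hMa.trans (min_le_right _ _)
  have h0 := hmaj x hM2 α₀ hα₀ hMa₂ U hU hU'
  -- the knit regime at this member and configuration
  have hMx : 0 ≤ (geo9Y x).M := hM₂.le.trans hM2
  have hMα : 0 ≤ (kGeo x.toKIdx).M * α₀ := mul_nonneg hMx hα₀.le
  have hKx : Kpl x.toKIdx ((kGeo x.toKIdx).M * α₀) * (kGeo x.toKIdx).L ^ 4 < α₀' := hKpl x _ hMα hMaK
  -- (2.142) at `U` for the block entry on the basis direction `b c.2`, at the knit pair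
  have h2142 := norm_QGQOfQY_deltaY_le_knit x.toKIdx (instF := (inferInstance : Fintype (geo9Y x).Site)) bK (B := bg9YR (Matrix (Fin N) (Fin N) ℂ) G R₁ R₂ x)
    (fun U => U) (T x) (𝔮 x) (𝔮s x) U (h𝔮 x U) (h𝔮s x U) hGU hc hMα (hRP x α₀ U hU) hα' hαQ hKx (hlev x) (hβ1 x) (hnbr x) hC hδ.le h0 a.1 c.1 (b c.2)
  -- the normalised entry through the block entry
  have h4 := abs_normMatY_le (X := (geo9Y x).Site) b (fun y => (lamInvY_pos x.toKIdx y).le) (QGQOfQY x.toKIdx (𝔮 x) (𝔮s x) (T x) U) a c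
  -- the level factor under the (2.60) threshold
  have hlog : ((d : ℝ) + 3) * Real.log (geo9Y x).L ≤ δ * (2 * ((ℓ : ℝ) + 1) ^ 2 - 1) * (geo9Y x).M := by
    have h1 : ((d : ℝ) + 3) * Real.log L = MT * (δ * (2 * ((ℓ : ℝ) + 1) ^ 2 - 1)) := by
      rw [hMT, div_mul_cancel₀ _ hden.ne']
    have hLx : (geo9Y x).L = L := rfl
    rw [hLx, h1, mul_comm]
    exact mul_le_mul_of_nonneg_left hMTx hden.le
  have h5 := levelFactor_le x.toKIdx hδ hlog a.1 c.1
  -- assemble (all lengths and distances in the `geo9Y x` spelling; plain real arithmetic on atoms)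
  have hκ := dimConstY'_pos b
  have hrepr : 0 ≤ ‖(b.equivFunL : Matrix (Fin N) (Fin N) ℂ →L[ℝ] (Ff → ℝ))‖ / dimConstY' b :=
    div_nonneg (norm_nonneg (b.equivFunL : Matrix (Fin N) (Fin N) ℂ →L[ℝ] (Ff → ℝ))) hκ.le
  have hbb0 : 0 ≤ basisBound39 b := Finset.sum_nonneg fun _ _ => norm_nonneg _
  have hbf : ‖b c.2‖ ≤ basisBound39 b := norm_basis_le b c.2
  have hdist : (geoComap (geo9Y x) (Prod.fst : (geo9Y x).Site × Ff → (geo9Y x).Site)).dist a c = (geo9Y x).dist a.1 c.1 := rfl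
  rw [hdist]
  have h2142' : ‖QGQOfQY x.toKIdx (𝔮 x) (𝔮s x) (T x) U (deltaY c.1 (b c.2)) a.1‖ ≤
      mN * CK * Real.exp (2 * (δ * ((ℓ : ℝ) + 4))) * (geo9Y x).len a.1 ^ 2 * ((((ℓ + 1 : ℕ) : ℝ) ^ (d + 1)) ^ (lvl x.hN x.D x.hk c.1))⁻¹ *
        Real.exp (-(δ * (geo9Y x).dist a.1 c.1)) * ‖b c.2‖ := by rw [hCK]; exact h2142
  have h5' : lamInvY x.toKIdx a.1 * lamInvY x.toKIdx c.1 * (geo9Y x).len a.1 ^ 2 * ((((ℓ + 1 : ℕ) : ℝ) ^ (d + 1)) ^ (lvl x.hN x.D x.hk c.1))⁻¹ ≤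
      L ^ (((d : ℝ) + 3) / 2) * Real.exp (δ / 2 * (geo9Y x).dist a.1 c.1) := h5
  -- chain the two estimates (the block entry is eliminated), then name the remaining atoms
  have s12 := h4.trans (mul_le_mul_of_nonneg_left h2142'
    (mul_nonneg (mul_nonneg (lamInvY_pos x.toKIdx a.1).le (lamInvY_pos x.toKIdx c.1).le) hrepr))
  generalize hΛa : lamInvY x.toKIdx a.1 = Λa at h5' s12
  generalize hΛc : lamInvY x.toKIdx c.1 = Λc at h5' s12
  generalize hla : (geo9Y x).len a.1 = la at s12 h5'
  generalize hpw : ((((ℓ + 1 : ℕ) : ℝ) ^ (d + 1)) ^ (lvl x.hN x.D x.hk c.1))⁻¹ = pw at s12 h5'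
  generalize hD : (geo9Y x).dist a.1 c.1 = D at s12 h5' ⊢
  generalize hr : ‖(b.equivFunL : Matrix (Fin N) (Fin N) ℂ →L[ℝ] (Ff → ℝ))‖ / dimConstY' b = r at s12 hrepr hB
  generalize hK : (mN : ℝ) * CK * Real.exp (2 * (δ * ((ℓ : ℝ) + 4))) = K at s12 hB
  generalize hnb : ‖b c.2‖ = nb at s12 hbf
  generalize hLB : L ^ (((d : ℝ) + 3) / 2) = LB at h5' hB
  have hK0 : 0 ≤ K := by rw [← hK]; positivity
  have hΛa0 : 0 ≤ Λa := by rw [← hΛa]; exact (lamInvY_pos _ _).le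
  have hΛc0 : 0 ≤ Λc := by rw [← hΛc]; exact (lamInvY_pos _ _).le
  have hpw0 : 0 ≤ pw := by rw [← hpw]; positivity
  have s3 : Λa * Λc * r * (K * la ^ 2 * pw * Real.exp (-(δ * D)) * nb) = r * K * nb * (Λa * Λc * la ^ 2 * pw) * Real.exp (-(δ * D)) := by ring
  have s4 : r * K * nb * (Λa * Λc * la ^ 2 * pw) * Real.exp (-(δ * D)) ≤ r * K * basisBound39 b * (LB * Real.exp (δ / 2 * D)) * Real.exp (-(δ * D)) := by
    refine mul_le_mul_of_nonneg_right ?_ (Real.exp_nonneg _)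
    exact mul_le_mul (mul_le_mul_of_nonneg_left hbf (mul_nonneg hrepr hK0)) h5'
      (mul_nonneg (mul_nonneg (mul_nonneg hΛa0 hΛc0) (sq_nonneg _)) hpw0) (mul_nonneg (mul_nonneg hrepr hK0) hbb0)
  have s5 : r * K * basisBound39 b * (LB * Real.exp (δ / 2 * D)) * Real.exp (-(δ * D)) = B * Real.exp (-(δ / 2 * D)) := by
    rw [hB, show Real.exp (-(δ / 2 * D)) = Real.exp (δ / 2 * D) * Real.exp (-(δ * D)) by
      rw [← Real.exp_add]; congr 1; ring]
    ring
  exact s12.trans (s3.le.trans (s4.trans s5.le))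

/-! ## §2 One member, one configuration: the normalised entry from a block majorant at the knit pair (the `CoerciveFromGA` transfer's input) -/

section Entry

/-- **THE NORMALISED ENTRY OF `Q T(U) Q⋆` AT THE KNIT PAIR FROM A BLOCK MAJORANT** (one member, one `U`, explicit constant, LINEAR in `C`) — the knit twin of n06-i's
`B9Eq3132StepDifference.abs_normMatY_QGQOfY_le_of_hasMajorant` (same proof, piece 1's (2.142)-at-`U`): letters `𝔮(cfg U₁) = QknitY`, `𝔮⋆(cfg U₁) = adjTrY (QknitY ·)`, `cfg U₁` in
`(bg9KP …).Reg335 c₀ α₀` (`G ≤ U(N)`, `c₀ ≤ 10`, `0 ≤ Mα₀`, `0 < α₀′ ≤ α_Q`, `K_pl(Mα₀)L⁴ < α₀′`), `bI` level-∕1-faithful, count `mN`, the (2.60) threshold `(d+3)log L ≤ δ(2L²−1)M`: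
`|diag(Λ⁻¹∕κ′)·reMatY(Q T(U) Q⋆)·diag(Λ⁻¹) (y,f) (y′,f′)| ≤ (Σ‖b_f‖)(‖repr_b‖∕κ′)(mN·e^{2δ(ℓ+4)})L^{(d+3)∕2}·((1+2(d+1)K_col α₀′)N⁴(1+K_col α₀′)·C)·e^{−(δ∕2)d(y,y′)}`.
[cite: Balaban1985BackgroundPropagators, (3.132) p.422, (3.115) p.418; Balaban1984PropagatorsII, (2.142) p.248, (2.149) p.249, (2.60) p.234] -/
theorem abs_normMatY_QGQOfQY_le_of_hasMajorant_knit (i : KIdx d ℓ hd hL b₀ b₁) [instF : Fintype (geo9K i).Site] [instD : DecidableEq (geo9K i).Site]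
    (bK : Module.Basis κ ℝ (Matrix (Fin N) (Fin N) ℂ)) (b : Module.Basis Ff ℝ (Matrix (Fin N) (Fin N) ℂ))
    {B : B9.Backgrounds} (cfg : B.Cfg → CfgY (Matrix (Fin N) (Fin N) ℂ) i) (T : BondOpY (Matrix (Fin N) (Fin N) ℂ) i)
    (𝔮 : QLetterY (Matrix (Fin N) (Fin N) ℂ) i) (𝔮s : QsLetterY (Matrix (Fin N) (Fin N) ℂ) i) (U₁ : B.Cfg)
    (h𝔮 : 𝔮 (cfg U₁) = QknitY i (cfg U₁)) (h𝔮s : 𝔮s (cfg U₁) = adjTrY (QknitY i (cfg U₁)))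
    (hGU : G ≤ unitaryUnits (Matrix (Fin N) (Fin N) ℂ))
    {c₀ α₀ : ℝ} (hc : c₀ ≤ 10) (hMα : 0 ≤ (kGeo i).M * α₀) (hreg : (bg9KP (Matrix (Fin N) (Fin N) ℂ) G i).Reg335 c₀ α₀ (cfg U₁))
    {α₀' : ℝ} (hα' : 0 < α₀') (hαQ : α₀' ≤ alphaQ (d + 1) (ℓ + 1)) (hK : Kpl i ((kGeo i).M * α₀) * (kGeo i).L ^ 4 < α₀')
    {bI : FBondY i → IBondY i}
    (hlev : ∀ f : FBondY i, lvl i.hN i.D i.hk (bI f) = (blkV1 i.hN i.D f).1.1)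
    (hβ1 : ∀ f : FBondY i, (B6Geom246MultiLevelTorus.geomT i.D).dist (β i.hN i.D i.hk (bI f)) (blkV1 i.hN i.D f) ≤ 1)
    {mN : ℕ} (hnbr : ∀ y : (geo9K i).Site, (nbr (geo9K i) ((ℓ : ℝ) + 4) y).card ≤ mN)
    {R : ℝ} {H : Prop} {C δ : ℝ} (hC : 0 ≤ C) (hδ : 0 < δ)
    (hM : ((d : ℝ) + 3) * Real.log (geo9K i).L ≤ δ * (2 * ((ℓ : ℝ) + 1) ^ 2 - 1) * (geo9K i).M)
    (h0 : HasMajorant (g := toB6 (geo9K i) R H) (blkBK i bI) (GcoK i bK B cfg T U₁)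
      (fun a a' => C * (geo9K i).len a ^ 2 * Real.exp (-(δ * (geo9K i).dist a a'))))
    (a c : (geo9K i).Site × Ff) :
    |normMatY (X := (geo9K i).Site) b (lamInvY i) (QGQOfQY i 𝔮 𝔮s T (cfg U₁)) a c| ≤
      basisBound39 b * (‖(b.equivFunL : Matrix (Fin N) (Fin N) ℂ →L[ℝ] (Ff → ℝ))‖ / dimConstY' b) * (mN * Real.exp (2 * (δ * ((ℓ : ℝ) + 4)))) *
        (((ℓ + 1 : ℕ) : ℝ)) ^ (((d : ℝ) + 3) / 2) *
        ((1 + kCol (d + 1) (ℓ + 1) * α₀' * (2 * ((d : ℝ) + 1))) * (N : ℝ) ^ 4 * (1 + kCol (d + 1) (ℓ + 1) * α₀') * C) *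
        Real.exp (-(δ / 2 * (geo9K i).dist a.1 c.1)) := by
  set CK : ℝ := (1 + kCol (d + 1) (ℓ + 1) * α₀' * (2 * ((d : ℝ) + 1))) * (N : ℝ) ^ 4 * (1 + kCol (d + 1) (ℓ + 1) * α₀') * C with hCK
  have hkc : 0 ≤ kCol (d + 1) (ℓ + 1) * α₀' := mul_nonneg (kCol_nonneg _ _) hα'.le
  have hCK0 : 0 ≤ CK := by rw [hCK]; positivity
  have h2142' := norm_QGQOfQY_deltaY_le_knit i bK cfg T 𝔮 𝔮s U₁ h𝔮 h𝔮s hGU hc hMα hreg hα' hαQ hK hlev hβ1 hnbr hC hδ.le h0 a.1 c.1 (b c.2)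
  have h2142 : ‖QGQOfQY i 𝔮 𝔮s T (cfg U₁) (deltaY c.1 (b c.2)) a.1‖ ≤
      mN * CK * Real.exp (2 * (δ * ((ℓ : ℝ) + 4))) * (geo9K i).len a.1 ^ 2 * ((((ℓ + 1 : ℕ) : ℝ) ^ (d + 1)) ^ (lvl i.hN i.D i.hk c.1))⁻¹ *
        Real.exp (-(δ * (geo9K i).dist a.1 c.1)) * ‖b c.2‖ := by rw [hCK]; exact h2142'
  have h4 := abs_normMatY_le (X := (geo9K i).Site) b (fun y => (lamInvY_pos i y).le) (QGQOfQY i 𝔮 𝔮s T (cfg U₁)) a c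
  have h5 := levelFactor_le i hδ hM a.1 c.1
  have hκ := dimConstY'_pos b
  have hrepr : 0 ≤ ‖(b.equivFunL : Matrix (Fin N) (Fin N) ℂ →L[ℝ] (Ff → ℝ))‖ / dimConstY' b :=
    div_nonneg (norm_nonneg (b.equivFunL : Matrix (Fin N) (Fin N) ℂ →L[ℝ] (Ff → ℝ))) hκ.le
  have hbb0 : 0 ≤ basisBound39 b := Finset.sum_nonneg fun _ _ => norm_nonneg _
  have hbf : ‖b c.2‖ ≤ basisBound39 b := norm_basis_le b c.2
  have hLx : (geo9K i).L = ((ℓ + 1 : ℕ) : ℝ) := rfl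
  rw [hLx] at h5
  have s12 := h4.trans (mul_le_mul_of_nonneg_left h2142
    (mul_nonneg (mul_nonneg (lamInvY_pos i a.1).le (lamInvY_pos i c.1).le) hrepr))
  generalize hΛa : lamInvY i a.1 = Λa at h5 s12
  generalize hΛc : lamInvY i c.1 = Λc at h5 s12
  generalize hla : (geo9K i).len a.1 = la at s12 h5
  generalize hpw : ((((ℓ + 1 : ℕ) : ℝ) ^ (d + 1)) ^ (lvl i.hN i.D i.hk c.1))⁻¹ = pw at s12 h5
  generalize hD : (geo9K i).dist a.1 c.1 = D at s12 h5 ⊢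
  generalize hr : ‖(b.equivFunL : Matrix (Fin N) (Fin N) ℂ →L[ℝ] (Ff → ℝ))‖ / dimConstY' b = r at s12 hrepr ⊢
  generalize hK' : (mN : ℝ) * CK * Real.exp (2 * (δ * ((ℓ : ℝ) + 4))) = K at s12 ⊢
  generalize hnb : ‖b c.2‖ = nb at s12 hbf
  generalize hLB : (((ℓ + 1 : ℕ) : ℝ)) ^ (((d : ℝ) + 3) / 2) = LB at h5 ⊢
  have hK0 : 0 ≤ K := by rw [← hK']; positivity
  have hΛa0 : 0 ≤ Λa := by rw [← hΛa]; exact (lamInvY_pos _ _).le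
  have hΛc0 : 0 ≤ Λc := by rw [← hΛc]; exact (lamInvY_pos _ _).le
  have hpw0 : 0 ≤ pw := by rw [← hpw]; positivity
  have s3 : Λa * Λc * r * (K * la ^ 2 * pw * Real.exp (-(δ * D)) * nb) = r * K * nb * (Λa * Λc * la ^ 2 * pw) * Real.exp (-(δ * D)) := by ring
  have s4 : r * K * nb * (Λa * Λc * la ^ 2 * pw) * Real.exp (-(δ * D)) ≤ r * K * basisBound39 b * (LB * Real.exp (δ / 2 * D)) * Real.exp (-(δ * D)) := by
    refine mul_le_mul_of_nonneg_right ?_ (Real.exp_nonneg _)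
    exact mul_le_mul (mul_le_mul_of_nonneg_left hbf (mul_nonneg hrepr hK0)) h5
      (mul_nonneg (mul_nonneg (mul_nonneg hΛa0 hΛc0) (sq_nonneg _)) hpw0) (mul_nonneg (mul_nonneg hrepr hK0) hbb0)
  have s5 : r * K * basisBound39 b * (LB * Real.exp (δ / 2 * D)) * Real.exp (-(δ * D)) =
      basisBound39 b * r * (mN * Real.exp (2 * (δ * ((ℓ : ℝ) + 4)))) * LB * CK * Real.exp (-(δ / 2 * D)) := by
    rw [show Real.exp (-(δ / 2 * D)) = Real.exp (δ / 2 * D) * Real.exp (-(δ * D)) by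
      rw [← Real.exp_add]; congr 1; ring, ← hK']
    ring
  exact s12.trans (s3.le.trans (s4.trans s5.le))

end Entry

end Summit.QuantumFields.YangMills.BalabanUVNodes.N06Eq3132DecayFromMajorantKnitQ

end
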